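import Summits.CriticalPhenomena.SAWScalingLimit.Theorems.SAWRenewalTightnessTubeLowerBoundCornerStaircase

/-!
# Crux `TubeLowerBound` (stmt-CriticalPhenomena-4730), line `Sketch` (= lasso-repair-poly-hw): helpers for the
domino staircase (stub S3 `stub_dominoStaircase`)

Lemmas for `stub_dominoStaircase : lasso inequality → count ceiling → FirstOctantTubeFloor` (assembled in
`SAWRenewalTightnessTubeLowerBoundDominoStaircase.lean`).  The staircase `0 → (a, b)`, `0 ≤ b ≤ a`, runs through
the corners `Q_j = (x_j, y_j) = (⌊j a/n⌋, ⌊j b/n⌋)`, `n = min(20, a)` (`CornerStaircase.nR/xc/yc`); a leg of length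
`L ≥ 1` (horizontal `Q_j → (x_{j+1}, y_j)`, vertical `(x_{j+1}, y_j) → Q_{j+1}`) is a parity unit step (if `L` is
even) followed by ONE generalised domino of radius `R = ⌊(L−1)/2⌋ ≥ 0`: walks `0 → (2R+1, 0)` confined to
`[−R, 3R+1] × [−R, R]`, of `x_c`-mass `≥ x_c/(16(2R+1))` (`DominoFloor` for `R ≥ 1`, the unit step for `R = 0`;
`generalDominoFloor`, `domV_floor`).  Consecutive pieces overlap; they are glued by the LASSO INEQUALITY (hypothesis `hL`,
no separation needed) inside the tube predicate, each gluing costing a factor `1/((M+1) A(M) A(N))`, which the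
count ceiling `c_k x_c^k ≤ (k+1)^C` (hypothesis `hC`, `A(M) ≤ (M+1)^{C+1}`, `A_le`) makes polynomial
(`glue_step`, `piece`).  The only geometry is the tube test for translated domino boxes (`tube_of_HD`,
`tube_of_VD`, via `infDist_segment_le_coord` and `alpha_dom`: `α + 2R ≤ a/10 + 1` whenever `2R < α = a/n`).
-/

noncomputable section

namespace Summit.CriticalPhenomena.SAWScalingLimit.Theorems.TubeLowerBound.LassoRepair

open scoped BigOperators Classical
open Literature.Probability.LatticeModels
open Literature.Probability.RandomPlanarGeometry Literature.Probability.RandomPlanarGeometry.SAW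
open Literature.Probability.Percolation.Contour (site_ext)
open Summit.CriticalPhenomena.SAWScalingLimit.Theorems.TubeLowerBound.LiebSimonStar
open Summit.CriticalPhenomena.SAWScalingLimit.Theorems.TubeLowerBound.LiebSimonStar.CornerStaircase

/-! ### Generalised dominoes -/

/-- **Generalised domino** (registered sub-goal `generalDominoFloor`).  For EVERY `R ≥ 0` the `x_c`-mass of
self-avoiding walks `0 → (2R+1, 0)` of length `≤ 2(2R−1)² + 1` confined to `[−R, 3R+1] × [−R, R]` is
`≥ x_c/(16(2R+1))`: `DominoFloor` for `R ≥ 1`, the unit east step for `R = 0`. -/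
theorem generalDominoFloor :
    DominoFloor → ∀ R : ℕ, criticalFugacity / (16 * (2 * (R : ℝ) + 1)) ≤
      ∑ n ∈ Finset.range (2 * (2 * R - 1) ^ 2 + 1 + 1),
        ∑ _ω ∈ (Zd.sawFun 2 n ![2 * (R : ℤ) + 1, 0]).filter
          (fun ω => ∀ i ≤ n, -(R : ℤ) ≤ ω i 0 ∧ ω i 0 ≤ 3 * (R : ℤ) + 1 ∧ |ω i 1| ≤ (R : ℤ)),
        criticalFugacity ^ n := by
  intro hD R
  rcases Nat.eq_zero_or_pos R with rfl | hR
  · have he : (![2 * ((0 : ℕ) : ℤ) + 1, 0] : Site 2) = Pi.single 0 1 := site_ext (by simp) (by simp)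
    have hx1 : criticalFugacity / (16 * (2 * ((0 : ℕ) : ℝ) + 1)) ≤ criticalFugacity := by
      rw [div_le_iff₀ (by positivity)]
      nlinarith [criticalFugacity_pos]
    have hN : 2 * (2 * 0 - 1) ^ 2 + 1 + 1 = 1 + 1 := by norm_num
    rw [he, hN]
    refine hx1.trans (CornerStaircase.criticalFugacity_le_tubeMass_step.trans ?_)
    refine CornerStaircase.tubeMass_mono (P := fun q : Site 2 => q = 0 ∨ q = Pi.single 0 1)
      (R := fun q : Site 2 => -((0 : ℕ) : ℤ) ≤ q 0 ∧ q 0 ≤ 3 * ((0 : ℕ) : ℤ) + 1 ∧ |q 1| ≤ ((0 : ℕ) : ℤ))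
      (fun q hq => ?_) 1 (Pi.single 0 1)
    rcases hq with rfl | rfl <;> simp
  · exact hD R hR

namespace DominoStaircase

/-! ### Tube geometry of the domino boxes -/

/-- With `α = a/n`, `n = min(20, a)`: if `2R < α` for a natural `R` then `α + 2R ≤ a/10 + 1` (for `a ≤ 20`,
`α = 1` forces `R = 0`; for `a ≥ 20`, `α = a/20`). -/
theorem alpha_dom {a R : ℕ} (ha : 1 ≤ a) (h : 2 * (R : ℝ) < (a : ℝ) / nR a) :
    (a : ℝ) / nR a + 2 * R ≤ (a : ℝ) / 10 + 1 := by
  have ha' : (1 : ℝ) ≤ a := by exact_mod_cast ha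
  unfold nR at h ⊢
  rcases le_total a 20 with h20 | h20
  · rw [min_eq_right h20, div_self (by positivity)] at h ⊢
    have hR : R = 0 := by
      by_contra hR
      have : (1 : ℝ) ≤ R := by exact_mod_cast Nat.one_le_iff_ne_zero.2 hR
      linarith
    subst hR
    have : (0 : ℝ) ≤ (a : ℝ) / 10 := by positivity
    push_cast
    linarith
  · rw [min_eq_left h20] at h ⊢
    push_cast at h ⊢
    linarith

/-- **Tube test, horizontal domino box.**  In round `j + 1`, a generalised domino of radius `R` placed on the
horizontal leg at abscissa `c` (`x_j ≤ c`, `c + 2R + 1 ≤ x_{j+1}`) has its box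
`[c − R, c + 3R + 1] × [y_j − R, y_j + R]` inside the tube: compare with the point of parameter `j/n`. -/
theorem tube_of_HD {a b j R : ℕ} (hj : j + 1 ≤ nR a) {c : ℤ} (hc : ((xc a j : ℕ) : ℤ) ≤ c)
    (hc' : c + 2 * R + 1 ≤ xc a (j + 1)) {p : Site 2} (h0 : c ≤ p 0 + R)
    (h0' : p 0 ≤ c + 3 * R + 1) (h1 : ((yc a b j : ℕ) : ℤ) ≤ p 1 + R)
    (h1' : p 1 ≤ yc a b j + R) : p ∈ tubeSet a b := by
  have hn : 0 < nR a := by omega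
  have ha : 1 ≤ a := le_trans (by omega : 1 ≤ nR a) (min_le_right 20 a)
  have hn' : (0 : ℝ) < nR a := by exact_mod_cast hn
  obtain ⟨hα1, -⟩ := alpha_facts ha
  obtain ⟨⟨-, hX'⟩, ⟨hY, hY'⟩⟩ := corner_real a b j hn
  obtain ⟨⟨hX1, -⟩, -⟩ := corner_real a b (j + 1) hn
  have e1 : ((j + 1 : ℕ) : ℝ) / nR a * a = (j : ℝ) / nR a * a + a / nR a := by push_cast; ring
  rw [e1] at hX1
  have rc : ((xc a j : ℕ) : ℝ) ≤ (c : ℝ) := by exact_mod_cast hc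
  have rc' : (c : ℝ) + 2 * R + 1 ≤ ((xc a (j + 1) : ℕ) : ℝ) := by exact_mod_cast hc'
  have r0 : (c : ℝ) ≤ ((p 0 : ℤ) : ℝ) + R := by exact_mod_cast h0
  have r0' : ((p 0 : ℤ) : ℝ) ≤ c + 3 * R + 1 := by exact_mod_cast h0'
  have r1 : ((yc a b j : ℕ) : ℝ) ≤ ((p 1 : ℤ) : ℝ) + R := by exact_mod_cast h1
  have r1' : ((p 1 : ℤ) : ℝ) ≤ ((yc a b j : ℕ) : ℝ) + R := by exact_mod_cast h1'
  have hdom := alpha_dom ha (R := R) (by linarith)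
  have hℓ := cast_le_ell0 a b
  have key := infDist_segment_le_coord a b p ((j : ℝ) / nR a) (by positivity)
    (by rw [div_le_one hn']; exact_mod_cast (by omega : j ≤ nR a))
  refine key.trans ?_
  have A : |((p 0 : ℤ) : ℝ) - (j : ℝ) / nR a * a| ≤ (a : ℝ) / nR a + R := by
    rw [abs_le]; constructor <;> linarith
  have B : |((p 1 : ℤ) : ℝ) - (j : ℝ) / nR a * b| ≤ R + 1 := by
    rw [abs_le]; constructor <;> linarith
  linarith

/-- **Tube test, vertical domino box.**  In round `j + 1`, a generalised domino of radius `R` placed on the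
vertical leg at ordinate `c` (`y_j ≤ c`, `c + 2R + 1 ≤ y_{j+1}`) has its box
`[x_{j+1} − R, x_{j+1} + R] × [c − R, c + 3R + 1]` inside the tube: compare with the point of abscissa `x_{j+1}`. -/
theorem tube_of_VD {a b j R : ℕ} (hba : b ≤ a) (hj : j + 1 ≤ nR a) {c : ℤ}
    (hc : ((yc a b j : ℕ) : ℤ) ≤ c) (hc' : c + 2 * R + 1 ≤ yc a b (j + 1)) {p : Site 2}
    (h0 : ((xc a (j + 1) : ℕ) : ℤ) ≤ p 0 + R) (h0' : p 0 ≤ xc a (j + 1) + R)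
    (h1 : c ≤ p 1 + R) (h1' : p 1 ≤ c + 3 * R + 1) : p ∈ tubeSet a b := by
  have hn : 0 < nR a := by omega
  have ha : 1 ≤ a := le_trans (by omega : 1 ≤ nR a) (min_le_right 20 a)
  have ha0 : (0 : ℝ) < a := by exact_mod_cast ha
  have hba' : (b : ℝ) ≤ a := by exact_mod_cast hba
  obtain ⟨hα1, -⟩ := alpha_facts ha
  obtain ⟨-, ⟨hY, hY'⟩⟩ := corner_real a b j hn
  obtain ⟨⟨hX1, hX1'⟩, ⟨hY1, -⟩⟩ := corner_real a b (j + 1) hn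
  have e1 : ((j + 1 : ℕ) : ℝ) / nR a * a = (j : ℝ) / nR a * a + a / nR a := by push_cast; ring
  have e2 : ((j + 1 : ℕ) : ℝ) / nR a * b = (j : ℝ) / nR a * b + b / nR a := by push_cast; ring
  rw [e1] at hX1 hX1'; rw [e2] at hY1
  have hβα : (b : ℝ) / nR a ≤ a / nR a := div_le_div_of_nonneg_right hba' (Nat.cast_nonneg _)
  have hxa : ((xc a (j + 1) : ℕ) : ℝ) ≤ a := by exact_mod_cast (corner_facts hba hj).2.2.2.2.2.2
  have rc : ((yc a b j : ℕ) : ℝ) ≤ (c : ℝ) := by exact_mod_cast hc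
  have rc' : (c : ℝ) + 2 * R + 1 ≤ ((yc a b (j + 1) : ℕ) : ℝ) := by exact_mod_cast hc'
  have r0 : ((xc a (j + 1) : ℕ) : ℝ) ≤ ((p 0 : ℤ) : ℝ) + R := by exact_mod_cast h0
  have r0' : ((p 0 : ℤ) : ℝ) ≤ ((xc a (j + 1) : ℕ) : ℝ) + R := by exact_mod_cast h0'
  have r1 : (c : ℝ) ≤ ((p 1 : ℤ) : ℝ) + R := by exact_mod_cast h1
  have r1' : ((p 1 : ℤ) : ℝ) ≤ c + 3 * R + 1 := by exact_mod_cast h1'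
  have hdom := alpha_dom ha (R := R) (by linarith)
  have hℓ := cast_le_ell0 a b
  -- the comparison point `(x_{j+1}, W)`, `W = x_{j+1} b / a`
  have key := infDist_segment_le_coord a b p (((xc a (j + 1) : ℕ) : ℝ) / a) (by positivity)
    (by rwa [div_le_one ha0])
  have es : ((xc a (j + 1) : ℕ) : ℝ) / a * a = ((xc a (j + 1) : ℕ) : ℝ) := by field_simp
  rw [es] at key
  have hW1 : ((xc a (j + 1) : ℕ) : ℝ) / a * b ≤ (j : ℝ) / nR a * b + b / nR a := by
    calc ((xc a (j + 1) : ℕ) : ℝ) / a * b = ((xc a (j + 1) : ℕ) : ℝ) * (b / a) := by ring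
      _ ≤ ((j : ℝ) / nR a * a + a / nR a) * (b / a) := mul_le_mul_of_nonneg_right hX1 (by positivity)
      _ = (j : ℝ) / nR a * b + b / nR a := by field_simp
  have hW2 : (j : ℝ) / nR a * b + b / nR a - 1 ≤ ((xc a (j + 1) : ℕ) : ℝ) / a * b := by
    have hba1 : (b : ℝ) / a ≤ 1 := by rwa [div_le_one ha0]
    calc (j : ℝ) / nR a * b + b / nR a - 1 ≤ (j : ℝ) / nR a * b + b / nR a - b / a := by linarith
      _ = ((j : ℝ) / nR a * a + a / nR a - 1) * (b / a) := by field_simp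
      _ ≤ ((xc a (j + 1) : ℕ) : ℝ) * (b / a) := mul_le_mul_of_nonneg_right hX1'.le (by positivity)
      _ = ((xc a (j + 1) : ℕ) : ℝ) / a * b := by ring
  refine key.trans ?_
  have A : |((p 0 : ℤ) : ℝ) - ((xc a (j + 1) : ℕ) : ℝ)| ≤ R := by
    rw [abs_le]; constructor <;> linarith
  have B : |((p 1 : ℤ) : ℝ) - ((xc a (j + 1) : ℕ) : ℝ) / a * b| ≤ (b : ℝ) / nR a + R + 1 := by
    rw [abs_le]; constructor <;> linarith
  linarith

/-! ### Vertical dominoes -/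

/-- **Vertical generalised domino**: the coordinate swap of `generalDominoFloor` — walks `0 → (0, 2R+1)` confined to
`[−R, R] × [−R, 3R+1]`. -/
theorem domV_floor (hD : DominoFloor) (R : ℕ) :
    criticalFugacity / (16 * (2 * (R : ℝ) + 1)) ≤
      ∑ n ∈ Finset.range (2 * (2 * R - 1) ^ 2 + 1 + 1),
        ∑ _ω ∈ (Zd.sawFun 2 n ![0, 2 * (R : ℤ) + 1]).filter
          (fun ω => ∀ i ≤ n, -(R : ℤ) ≤ ω i 1 ∧ ω i 1 ≤ 3 * (R : ℤ) + 1 ∧ |ω i 0| ≤ (R : ℤ)),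
        criticalFugacity ^ n :=
  (generalDominoFloor hD R).trans (tubeMass_swap_le
    (P := fun p : Site 2 => -(R : ℤ) ≤ p 0 ∧ p 0 ≤ 3 * (R : ℤ) + 1 ∧ |p 1| ≤ (R : ℤ))
    (P' := fun p : Site 2 => -(R : ℤ) ≤ p 1 ∧ p 1 ≤ 3 * (R : ℤ) + 1 ∧ |p 0| ≤ (R : ℤ))
    (fun p hp => by simpa using hp) _ (by simp) (by simp))

/-! ### Gluing by the lasso inequality under the count ceiling -/

section Lasso

variable (hL : ∀ (P Q R : Site 2 → Prop) [DecidablePred P] [DecidablePred Q] [DecidablePred R]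
      (e₁ e₂ e : Site 2), e₁ + e₂ = e → (∀ p, P p → R p) → (∀ q, Q q → R (e₁ + q)) → ∀ (M N : ℕ),
      (∑ m ∈ Finset.range (M + 1),
          ∑ _ω ∈ (Zd.sawFun 2 m e₁).filter (fun ω => ∀ i ≤ m, P (ω i)), criticalFugacity ^ m) *
        (∑ n ∈ Finset.range (N + 1),
          ∑ _ω ∈ (Zd.sawFun 2 n e₂).filter (fun ω => ∀ i ≤ n, Q (ω i)), criticalFugacity ^ n) ≤
      ((M : ℝ) + 1) * (∑ k ∈ Finset.range (M + 1), (Zd.count 2 k : ℝ) * criticalFugacity ^ k) *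
        (∑ k ∈ Finset.range (N + 1), (Zd.count 2 k : ℝ) * criticalFugacity ^ k) *
        ∑ k ∈ Finset.range (M + N + 1),
          ∑ _ω ∈ (Zd.sawFun 2 k e).filter (fun ω => ∀ i ≤ k, R (ω i)), criticalFugacity ^ k)
  {Cn : ℕ} (hC : ∀ n : ℕ, (Zd.count 2 n : ℝ) * criticalFugacity ^ n ≤ ((n : ℝ) + 1) ^ Cn)

include hC in
/-- Under the count ceiling `c_k x_c^k ≤ (k+1)^C` the unconfined partial sums satisfy
`A(M) = Σ_{k ≤ M} c_k x_c^k ≤ (M+1)^{C+1}`. -/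
theorem A_le (M : ℕ) :
    (∑ k ∈ Finset.range (M + 1), (Zd.count 2 k : ℝ) * criticalFugacity ^ k) ≤ ((M : ℝ) + 1) ^ (Cn + 1) := by
  calc (∑ k ∈ Finset.range (M + 1), (Zd.count 2 k : ℝ) * criticalFugacity ^ k)
      ≤ ∑ _k ∈ Finset.range (M + 1), ((M : ℝ) + 1) ^ Cn := by
        refine Finset.sum_le_sum fun k hk => (hC k).trans (pow_le_pow_left₀ (by positivity) ?_ Cn)
        have : (k : ℝ) ≤ M := by exact_mod_cast Nat.lt_succ_iff.1 (Finset.mem_range.1 hk)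
        linarith
    _ = ((M : ℝ) + 1) ^ (Cn + 1) := by
        rw [Finset.sum_const, Finset.card_range, nsmul_eq_mul, pow_succ']
        push_cast
        ring

include hL hC in
/-- **One gluing.**  If `B ≤ T(P, e₁, M)` and a piece `Q` (with `e₁ + Q ⊆ P`) has mass `≥ f` within budget `N`,
then `B γ ≤ T(P, e₁ + e₂, M + N)` for every `γ ≥ 0` with `γ (M_tot+1)^{2C+3} ≤ f`, `M, N ≤ M_tot`: the lasso
inequality with `R := P` and the bounds `M + 1 ≤ M_tot + 1`, `A(M), A(N) ≤ (M_tot+1)^{C+1}`. -/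
theorem glue_step {P Q : Site 2 → Prop} [DecidablePred P] [DecidablePred Q] {e₁ e₂ : Site 2}
    (hQ : ∀ q, Q q → P (e₁ + q)) {M N Mtot : ℕ} (hM : M ≤ Mtot) (hN : N ≤ Mtot) {B γ f : ℝ}
    (hγ0 : 0 ≤ γ)
    (hB : B ≤ ∑ n ∈ Finset.range (M + 1),
      ∑ _ω ∈ (Zd.sawFun 2 n e₁).filter (fun ω => ∀ i ≤ n, P (ω i)), criticalFugacity ^ n)
    (hf : f ≤ ∑ n ∈ Finset.range (N + 1),
      ∑ _ω ∈ (Zd.sawFun 2 n e₂).filter (fun ω => ∀ i ≤ n, Q (ω i)), criticalFugacity ^ n)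
    (hγ : γ * ((Mtot : ℝ) + 1) ^ (2 * Cn + 3) ≤ f) :
    B * γ ≤ ∑ n ∈ Finset.range (M + N + 1),
      ∑ _ω ∈ (Zd.sawFun 2 n (e₁ + e₂)).filter (fun ω => ∀ i ≤ n, P (ω i)), criticalFugacity ^ n := by
  have h := hL P Q P e₁ e₂ (e₁ + e₂) rfl (fun _ hp => hp) hQ M N
  set TP := ∑ n ∈ Finset.range (M + 1),
      ∑ _ω ∈ (Zd.sawFun 2 n e₁).filter (fun ω => ∀ i ≤ n, P (ω i)), criticalFugacity ^ n
  set TQ := ∑ n ∈ Finset.range (N + 1),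
      ∑ _ω ∈ (Zd.sawFun 2 n e₂).filter (fun ω => ∀ i ≤ n, Q (ω i)), criticalFugacity ^ n
  set TR := ∑ n ∈ Finset.range (M + N + 1),
      ∑ _ω ∈ (Zd.sawFun 2 n (e₁ + e₂)).filter (fun ω => ∀ i ≤ n, P (ω i)), criticalFugacity ^ n
  set G : ℝ := ((Mtot : ℝ) + 1) ^ (2 * Cn + 3) with hG
  have hG0 : 0 < G := by positivity
  have hTP0 : 0 ≤ TP :=
    Finset.sum_nonneg fun _ _ => Finset.sum_nonneg fun _ _ => pow_nonneg criticalFugacity_pos.le _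
  have hTR0 : 0 ≤ TR :=
    Finset.sum_nonneg fun _ _ => Finset.sum_nonneg fun _ _ => pow_nonneg criticalFugacity_pos.le _
  have hA0 : ∀ K : ℕ, 0 ≤ ∑ k ∈ Finset.range (K + 1), (Zd.count 2 k : ℝ) * criticalFugacity ^ k :=
    fun K => Finset.sum_nonneg fun _ _ => mul_nonneg (Nat.cast_nonneg _) (pow_nonneg criticalFugacity_pos.le _)
  have hA : ∀ K : ℕ, K ≤ Mtot → (∑ k ∈ Finset.range (K + 1), (Zd.count 2 k : ℝ) * criticalFugacity ^ k) ≤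
      ((Mtot : ℝ) + 1) ^ (Cn + 1) := fun K hK =>
    (A_le hC K).trans (pow_le_pow_left₀ (by positivity) (by exact_mod_cast Nat.succ_le_succ hK) _)
  have hcoef : ((M : ℝ) + 1) * (∑ k ∈ Finset.range (M + 1), (Zd.count 2 k : ℝ) * criticalFugacity ^ k) *
      (∑ k ∈ Finset.range (N + 1), (Zd.count 2 k : ℝ) * criticalFugacity ^ k) ≤ G := by
    calc _ ≤ ((Mtot : ℝ) + 1) * ((Mtot : ℝ) + 1) ^ (Cn + 1) * ((Mtot : ℝ) + 1) ^ (Cn + 1) :=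
          mul_le_mul (mul_le_mul (by exact_mod_cast Nat.succ_le_succ hM) (hA M hM) (hA0 M)
            (by positivity)) (hA N hN) (hA0 N) (by positivity)
      _ = G := by rw [hG]; ring
  refine le_of_mul_le_mul_right ?_ hG0
  calc B * γ * G = B * (γ * G) := by ring
    _ ≤ TP * f := mul_le_mul hB hγ (by positivity) hTP0
    _ ≤ TP * TQ := mul_le_mul_of_nonneg_left hf hTP0
    _ ≤ _ := h
    _ ≤ G * TR := mul_le_mul_of_nonneg_right hcoef hTR0
    _ = TR * G := mul_comm _ _

variable {a b : ℕ} {γ : ℝ} (hγ0 : 0 ≤ γ)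
  (hγW : γ * (((80 * (8 * a ^ 2 + 1) : ℕ) : ℝ) + 1) ^ (2 * Cn + 3) ≤
    criticalFugacity / (16 * (2 * (a : ℝ) + 1)))

include hL hC hγ0 hγW in
/-- **One piece.**  Gluing a generalised domino of radius `R ≤ a` (in either orientation: its floor `hfl` is
`generalDominoFloor` or `domV_floor`), whose translate by the current endpoint `e₁` lies in the tube, to a family of
tube-confined walks `0 → e₁` of mass `≥ γ^k` within budget `M ≤ k (8a² + 1)` yields tube-confined walks
`0 → e₁ + e₂` of mass `≥ γ^{k+1}` within budget `≤ (k+1)(8a² + 1)` — provided `k + 1 ≤ 80` pieces in all and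
`γ (80 (8a²+1) + 1)^{2C+3} ≤ x_c/(16(2a+1))`, the uniform cost of a piece. -/
theorem piece {Q : Site 2 → Prop} [DecidablePred Q] {e₁ e₂ : Site 2} {R : ℕ} (hR : R ≤ a)
    (hfl : criticalFugacity / (16 * (2 * (R : ℝ) + 1)) ≤
      ∑ n ∈ Finset.range (2 * (2 * R - 1) ^ 2 + 1 + 1),
        ∑ _ω ∈ (Zd.sawFun 2 n e₂).filter (fun ω => ∀ i ≤ n, Q (ω i)), criticalFugacity ^ n)
    (hQ : ∀ q, Q q → e₁ + q ∈ tubeSet a b) {k M : ℕ} (hk : k + 1 ≤ 80) (hM : M ≤ k * (8 * a ^ 2 + 1))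
    (hB : γ ^ k ≤ ∑ n ∈ Finset.range (M + 1),
      ∑ _ω ∈ (Zd.sawFun 2 n e₁).filter (fun ω => ∀ i ≤ n, ω i ∈ tubeSet a b), criticalFugacity ^ n) :
    ∃ M' : ℕ, M' ≤ (k + 1) * (8 * a ^ 2 + 1) ∧ γ ^ (k + 1) ≤ ∑ n ∈ Finset.range (M' + 1),
      ∑ _ω ∈ (Zd.sawFun 2 n (e₁ + e₂)).filter (fun ω => ∀ i ≤ n, ω i ∈ tubeSet a b),
        criticalFugacity ^ n := by
  have hNd : 2 * (2 * R - 1) ^ 2 + 1 ≤ 8 * a ^ 2 + 1 := by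
    have h1 : 2 * R - 1 ≤ 2 * a := by omega
    have h2 : (2 * R - 1) ^ 2 ≤ (2 * a) ^ 2 := Nat.pow_le_pow_left h1 2
    nlinarith [h2]
  refine ⟨M + (2 * (2 * R - 1) ^ 2 + 1), ?_, ?_⟩
  · rw [add_one_mul]
    exact add_le_add hM hNd
  · rw [pow_succ]
    refine glue_step hL hC (P := fun p : Site 2 => p ∈ tubeSet a b) hQ (Mtot := 80 * (8 * a ^ 2 + 1))
      (hM.trans (Nat.mul_le_mul_right _ (by omega)))
      (hNd.trans (Nat.le_mul_of_pos_left _ (by norm_num))) hγ0 hB hfl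
      (hγW.trans ?_)
    have : (R : ℝ) ≤ a := by exact_mod_cast hR
    exact div_le_div_of_nonneg_left criticalFugacity_pos.le (by positivity) (by linarith)

end Lasso

end DominoStaircase

end Summit.CriticalPhenomena.SAWScalingLimit.Theorems.TubeLowerBound.LassoRepair

end
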